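import Summits.QuantumFields.QCD.Theses.HeatSlicedQuarks
import Literature.MathematicalPhysics.QuantumLattice.OverlapLocality

/-!
# Disproof work file — crux `ActionBoundsLowModes` (stmt-QuantumFields-8872, route HeatSlicedQuarks)

Standing adversary's Lean record (cdisprove seat `refuter-cdisprove-stmt-QuantumFields-8872-0`).
The crux (Courant–Fischer form of a CLR / Lieb–Thirring count for Wilson fermions):

  `∃ C, ∀ L U m ∈ [−1/2, 1], ∀ λ ≥ 0, ∀ E ≤ ℂ^{Λ_L × 3 × 4}` with `‖D_W(U,m,1) v‖² ≤ λ ‖v‖²` on `E`: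
  `dim E ≤ C · (λ² L⁴ + S_W(U) + 1)`,   `S_W = Σ_{x, i<j} (3 − Re tr U_p)` (tree `wilsonAction`).

Equivalently (min–max): `N_{U,m}(λ) := #{eigenvalues of H = D_Wᴴ D_W ≤ λ} ≤ C(λ²L⁴ + S_W + 1)`.

## Findings (cycle 1, 2026-08-16) — NO KILL so far; the statement resists for structural reasons

* CONVENTIONS are the honest ones (so no cheap convention kill): `wilsonDirac` is
  `(m+4r)δ − ½Σ_μ[(r−γ_μ)U(x,μ)δ_{y,x+μ̂} + (r+γ_μ)U(y,μ)⁻¹δ_{x,y+μ̂}]` (free symbol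
  `m + Σ(1−cos p_μ) + iΣγ_μ sin p_μ`, critical free mass `m = 0`, doublers at `−2,−4,−6,−8`), and
  `wilsonAction ≥ 0` (`wilsonAction_nonneg` below).  On the `1⁴` torus `D_W(1, m) = m·1` exactly
  (`wilsonDirac_trivialConfig_one`).
* (a) LOAD-BEARING TERMS, as theorems: the `+1` is necessary (`not_withoutOne`: 12 constant zero modes,
  `λ = 0`, `S_W = 0`); the Weyl term `λ²L⁴` is necessary (`not_withoutWeyl`: `λ = 81 ≥ ‖D_W‖²` by the
  tree's HJL bound `‖D_W(m)‖ ≤ |m+4| + 4`, whole space, `S_W(1) = 0`, `dim = 12L⁴`).  The ACTION term is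
  necessary too but only numerically witnessed (constant abelian flux with `n` quanta in both planes,
  `m = −B`: ≈ `2n²` Wilson-shifted lowest-Landau-level modes below `λ ≪ L⁻²` against `λ²L⁴ + 1 = O(1)`;
  exact zero modes of `D_W` at `m < 0` are real-eigenvalue crossings, not constructible by hand in Lean).
* (b) TIGHTNESS: any admissible constant has `C ≥ 12` (`twelve_le_of_holds`); I know no configuration
  forcing `C > 12` (flux `n = 1`: 4 crossing modes per `4π²` of action; instanton: 1 per `≈ 4π²(1 − c/ρ²)`).
* WHY IT RESISTS (informal, for the provers):
  1. Flat connections (`S_W = 0`) are gauge-equivalent to constant commuting holonomies = the free operator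
     at shifted momenta `p + θ^a`; free `H(p) = (m + W)² + Σ sin² p_μ ≥ m²` for `m ≥ −1`
     (`H − m² = 2(1+m)W + (W² − Σ_μ a_μ²) ≥ 0`, `a_μ = 1 − cos p_μ`, `W = Σ a_μ`), zero only at `p = 0, m = 0`;
     lattice-point counting gives `N ≤ 12·#{p : (1+m)|p|² ≲ λ − m²} ≤ C(λ²L⁴ + 1)`.
  2. Constant abelian flux `B = 2πn/L²` in the (0,1) planes: `≈ 4n` LLL branches cross zero near
     `m ≈ −B/2`, each dressed by the transverse tower `|p_⊥|²`: `N(λ) ≈ n(λL²/π) + 4n` while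
     `S_W ≈ B²L⁴ = 4π²n²`; the mixed term is absorbed by AM–GM, `nλL² ≤ ½(λ²L⁴ + n²)`.  Flux in both
     planes: modes `≈ 2n²`, action `≈ 8π²n²` — linear (BPS).  Nothing sub-quadratic in the flux exists
     because the LLL degeneracy IS the flux.
  3. Continuum analogue is TRUE: `D̸ᴴD̸ = ∇ᴴ∇ + ½σ·F ≥ ∇ᴴ∇ − c|F|`, Kato/diamagnetic domination of the
     bundle heat kernel by the scalar one, and CLR in `d = 4 ≥ 3`:
     `N(D̸ᴴD̸ ≤ λ) ≤ N(−Δ_A − c|F| − λ ≤ 0) ≤ C∫(c|F| + λ)² ≤ C'(∫|F|² + λ² Vol)` — exactly the crux's shape.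
     So a counterexample must be a LATTICE ARTEFACT at `m ∈ [−1/2, 0)` (at `m ≥ 0` accretivity
     `Re D_W = m + ½K_U ≥ m` kills near-zero modes outright for `m > 0`).
  4. DILUTE-GAS REDUCTION (the one real attack): let
     `s_min(m₀) := inf { S_W(U) : L ≥ 1, U on Λ_L, D_W(U, m₀, 1) singular }`.  If
     `inf_{m₀ ∈ [−1/2, 0)} s_min(m₀) = 0` the crux is FALSE: take a localised witness `(U₀, v₀)` with action
     `s₀ < 1/(2C)`, place `n` translates at mutual distance `d` on a torus of side `L ~ n^{1/4} d`
     (`D_W` has range 1, the translated `v`'s and their images have disjoint supports, so on their span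
     `‖D_W v‖² ≤ λ‖v‖²` with `λ = O(e^{−c|m₀|d})` from the exponential tails in the free gap `m₀²`); then
     `dim = n` against `C(λ²L⁴ + n s₀ + 1) ≤ n/2 + C + o(1)`.  Conversely `s_min` bounded below on
     `[−1/2, 0)` is what a proof must effectively establish (Neuberger/HJL plaquette bounds give
     `s_min(m₀) > 0` for each FIXED `m₀ < 0`, since a crossing needs `max_p ‖1 − U_p‖ ≳ |m₀|`, but they
     degenerate as `m₀ → 0⁻`).  Heuristic for boundedness: in `d = 4` there is no weak-coupling binding —
     a field of strength `δ` on a region of radius `R` has Birman–Schwinger norm `~ δR²` at the threshold,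
     so a mid-gap state needs `δR² ≳ 1`, i.e. action `δ²R⁴ ≳ 1`, uniformly in the gap `|m₀|` (scale
     invariance of `∫F²` in 4D); smooth witnesses are instantons (`4π²`) or constant flux quanta (`4π²`
     for 4 modes).  NUMERICS (kit jobs j008302 scan, j008307 flow, j008310 opt = direct minimisation of
     `S_W` on the crossing manifold `{H_W(U,m₀) singular}` on `4⁴`, j008312 lich; results appended below
     when they land) measure `s_min(m₀)` for `m₀ ∈ {−0.5, −0.35, −0.2, −0.1, −0.05}`.
  5. The mass window: the free Lichnerowicz margin `H − ½K = m² + (2m+1)W + (W² − Σa_μ²)` is `≥ m²` iff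
     `m ≥ −1/2` (route support 8874 is sharp there), but the CRUX ITSELF is not obviously false below
     `−1/2`: `θK ≤ H` holds freely for `θ ≤ 1 + m`, so the CLR mechanism extends to `m ∈ (−1, 1]` with
     constants blowing up at `m → −1⁺` (where the free `H` has the flat band `H ≡ 1` on single-axis
     momenta).  Probed numerically at `m ∈ {−0.75, −1, −1.5}` in j008302 for the planner's kill criterion.
* LITERATURE (negative-side, materialised and read 2026-08-16):
  - Berruto–Narayanan–Neuberger, "Exact local fermionic zero modes", Phys. Lett. B 489 (2000) 243,
    hep-lat/0006030, §4–§6: exact zero modes of the Wilson operator bound to SMALL clusters exist only deep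
    in the supercritical region — single-site "fluxon" (4 links = −1): first zero at `m = −2.88` (4D);
    U(1) fields on a 4-link cluster: only `m < −2.5`; on a hypercube: `m < −1.7`; SU(2) on a hypercube:
    `m < −1.1` (their Fig. "defect").  So in the crux's window `m ∈ [−1/2, 0)` every crossing
    configuration is EXTENDED (diameter ≥ 2 lattice spacings) — consistent with item 4: no lattice-scale
    dislocation reaches mid-gap at small `|m|`; the cheapest crossing objects there are fat lumps.
  - Edwards–Heller–Narayanan, "Spectral flow, chiral condensate and topology in lattice QCD",
    Nucl. Phys. B 535 (1998) 403, hep-lat/9802016 (their `m` is `−m` here): on quenched SU(3) ensembles the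
    gap of `H_W(m)` closes at `m₁(β)` (`m₁ = 1.02` at β = 5.7, decreasing with β) and stays closed to the
    doubler point; crossing modes are localised with size decreasing monotonically in `|m|` from several
    lattice spacings near `m₁` to 1–2 spacings deep inside; smooth-instanton flows [their refs su2_inst]
    cross near `m = 0⁻` with 't Hooft-shaped modes.  Again: small `|m|` ⇔ large objects ⇔ `O(4π²)` action.
  - Neuberger, Phys. Rev. D 61 (2000) 085015 and Hernández–Jansen–Lüscher 1999 (tree: `OverlapLocality`,
    `HJLLocality`, PROVED norm bound `l2_opNorm_wilsonDirac_le`): uniform plaquette smallness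
    `‖1 − U_p‖ ≤ ε` opens a gap of `H_W(m)²` away from `m ∈ {0, −2}`; hence `s_min(m₀) ≥ c(m₀) > 0` for
    each fixed `m₀ < 0` (a crossing needs SOME plaquette with `‖1 − U_p‖ ≳ |m₀|`), with `c(m₀) → 0` as
    `m₀ → 0⁻` — the bound that a proof of the crux must beat by using the TOTAL action, not the sup.
  - No printed CLR / Lieb–Thirring inequality for lattice Dirac or Wilson operators was found (searchd was
    down this session; galaxy pdf corpus: 0 relevant rows for "spectral flow … Wilson", 30 generic rows for
    "Wilson-Dirac operator"); grounders recorded the same (Rozenblum–Solomyak discrete CLR is scalar).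
* BARRIERS consulted: `VafaWittenEigenvalueBound` (opposite direction: upper bounds on low eigenvalues —
  consistent), `BanksCasherCriterion` (density of states `ρ(0) > 0` only at `S_W ~ L⁴`, consistent),
  `AokiPhase` (gapless `H_W(m₀)` inside the Aoki phase — again at action densities `O(1)` per site, where
  the bound is slack: `N ≤ 12L⁴ ≤ C·S_W`), `NoContinuousLatticeTopologicalCharge` (config space is
  connected, so crossings exist along every path `Q: 0 → 1`; their minimal action is the dislocation
  threshold, an `O(1)`–`O(10)` number for the Wilson action, not `0`).  `ledger negatives`: none for QCD.

LANDED (p73725, accepted 2026-08-16T01:28Z): `Summits/QuantumFields/QCD/Theorems/ActionBoundsLowModes/Negative/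
LoadBearing.lean` — namespace `Summit.QuantumFields.QCD.Theorems.ActionBoundsLowModes.Negative`: the same
theorems as (a)/(b) below under the names `actionBoundsLowModes_false_without_one`,
`actionBoundsLowModes_false_without_weyl`, `actionBoundsLowModes_twelve_le_const`,
`actionBoundsLowModes_false_of_const_lt_twelve`, defs `ActionBoundsLowModesWith(outOne|outWeyl)`,
helpers `wilsonDirac_trivialConfig_one`, `wilsonAction_trivialConfig`, `wilsonAction_nonneg`,
`finrank_top_quarkFields`, `hyp_top_81` — IMPORT THAT MODULE in lines/skeletons; this work file keeps
self-contained copies only so that it elaborates against any farm snapshot.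

Sections: (a) load-bearing `not_withoutOne`, `not_withoutWeyl`; (b) tightness `twelve_le_of_holds`;
(c) strengthenings — see (a); (d) Targets — none yet (no skeleton/stubs); (e) near-misses — none sorried.
-/

open scoped Matrix.Norms.L2Operator
open Literature.MathematicalPhysics.QuantumLattice Literature.MathematicalPhysics.QuantumFieldTheory
open Literature.Probability.LatticeModels (TorusSite)

namespace Summit.QuantumFields.QCD.Cruxes.ActionBoundsLowModes.Disproof

local notation "SU3" => Matrix.specialUnitaryGroup (Fin 3) ℂ
local notation "ρ₃" => fundamentalRep (Fin 3)

/-! ## The crux with its constant exposed -/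

/-- The body of the crux with its constant exposed: `ActionBoundsLowModes ↔ ∃ C, Holds C`. -/
def Holds (C : ℝ) : Prop :=
  ∀ (L : ℕ) [NeZero L] (U : GaugeConfig 4 L SU3) (m : ℝ), m ∈ Set.Icc (-(1 / 2 : ℝ)) 1 →
    ∀ (lam : ℝ), 0 ≤ lam → ∀ (E : Submodule ℂ (TorusSite 4 L × Fin 3 × Fin 4 → ℂ)),
      (∀ v ∈ E, ∑ i, ‖(wilsonDirac ρ₃ U m 1).mulVec v i‖ ^ 2 ≤ lam * ∑ i, ‖v i‖ ^ 2) →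
        (Module.finrank ℂ E : ℝ) ≤ C * (lam ^ 2 * (L : ℝ) ^ 4 + wilsonAction ρ₃ U + 1)

/-- The crux is `∃ C, Holds C` (definitionally). -/
theorem actionBoundsLowModes_iff :
    Theses.HeatSlicedQuarks.ActionBoundsLowModes ↔ ∃ C, Holds C := Iff.rfl

/-- `Re tr g ≤ 3` on `SU(3)` (unitary entries have modulus `≤ 1`). -/
theorem re_trace_fundamentalRep_le_three (g : SU3) : ((ρ₃ g).trace).re ≤ 3 := by
  have hU : (g : Matrix (Fin 3) (Fin 3) ℂ) ∈ Matrix.unitaryGroup (Fin 3) ℂ :=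
    fundamentalRep_mem_unitaryGroup g
  rw [fundamentalRep_apply, Matrix.trace, Complex.re_sum]
  calc ∑ i, (Matrix.diag (g : Matrix (Fin 3) (Fin 3) ℂ) i).re ≤ ∑ _i : Fin 3, (1 : ℝ) :=
        Finset.sum_le_sum fun i _ =>
          ((le_abs_self _).trans (Complex.abs_re_le_norm _)).trans (entry_norm_bound_of_unitary hU i i)
    _ = 3 := by simp

/-- The tree's Wilson action of an `SU(3)` field is non-negative. -/
theorem wilsonAction_nonneg (L : ℕ) [NeZero L] (U : GaugeConfig 4 L SU3) :
    0 ≤ wilsonAction ρ₃ U := by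
  unfold wilsonAction
  refine Finset.sum_nonneg fun p _ => ?_
  push_cast
  linarith [re_trace_fundamentalRep_le_three (plaquetteHolonomy U p.1 p.2.1.1 p.2.1.2)]

/-- Monotonicity in the constant. -/
theorem Holds.mono {C C' : ℝ} (h : Holds C) (hCC' : C ≤ C') : Holds C' := by
  intro L _ U m hm lam hlam E hE
  refine (h L U m hm lam hlam E hE).trans ?_
  have h0 : 0 ≤ lam ^ 2 * (L : ℝ) ^ 4 + wilsonAction ρ₃ U + 1 := by
    have hS := wilsonAction_nonneg L U
    positivity
  exact mul_le_mul_of_nonneg_right hCC' h0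

/-! ## The trivial configuration and the one-point torus -/

/-- The trivial (unit) gauge configuration. -/
def trivialConfig (L : ℕ) : GaugeConfig 4 L SU3 := fun _ => 1

/-- `S_W(U ≡ 1) = 0`. -/
theorem wilsonAction_trivialConfig (L : ℕ) [NeZero L] : wilsonAction ρ₃ (trivialConfig L) = 0 := by
  simp [wilsonAction, trivialConfig, plaquetteHolonomy, Matrix.trace_one]

/-- On the one-point torus the free Wilson–Dirac operator is the scalar `m`: all hops are on-site and
the Wilson term cancels the `4r` exactly (`r = 1`). -/
theorem wilsonDirac_trivialConfig_one (m : ℝ) :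
    wilsonDirac ρ₃ (trivialConfig 1) m 1 = ((m : ℂ)) • (1 : Matrix _ _ ℂ) := by
  ext ⟨x, a, α⟩ ⟨y, b, β⟩
  have hxy : x = y := Subsingleton.elim _ _
  subst hxy
  simp only [wilsonDirac, trivialConfig, Matrix.of_apply, map_one, inv_one, Matrix.smul_apply,
    Matrix.sub_apply, Matrix.add_apply, Matrix.one_apply, smul_eq_mul,
    eq_iff_true_of_subsingleton, if_true, Prod.mk.injEq, true_and]
  have key : ∀ μ : Fin 4, ((((1:ℝ):ℂ) * if α = β then (1:ℂ) else 0) - euclideanGamma μ α β) *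
      (if a = b then (1:ℂ) else 0) +
      ((((1:ℝ):ℂ) * if α = β then (1:ℂ) else 0) + euclideanGamma μ α β) * (if a = b then (1:ℂ) else 0)
      = 2 * ((if α = β then (1:ℂ) else 0) * (if a = b then (1:ℂ) else 0)) := fun μ => by push_cast; ring
  simp only [key, Finset.sum_const, Finset.card_univ, Fintype.card_fin, nsmul_eq_mul]
  by_cases hab : a = b
  · by_cases hαβ : α = β
    · simp [hab, hαβ]; ring
    · simp [hab, hαβ]
  · simp [hab]

/-- `dim` of the whole quark-field space on the torus of side `L` is `12 L⁴`. -/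
theorem finrank_top_quarkFields (L : ℕ) [NeZero L] :
    Module.finrank ℂ (⊤ : Submodule ℂ (TorusSite 4 L × Fin 3 × Fin 4 → ℂ)) = 12 * L ^ 4 := by
  rw [finrank_top, Module.finrank_fintype_fun_eq_card]
  simp [Fintype.card_prod, ZMod.card, Fintype.card_fin]
  ring

/-- The hypothesis of the crux holds on the WHOLE space with `λ = 81`, for every `L`, every SU(3) field
and every `m ∈ [−1/2, 1]`: `‖D_W(m)‖ ≤ |m + 4| + 4 ≤ 9` (tree: `l2_opNorm_wilsonDirac_le`, HJL (2.14)). -/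
theorem hyp_top_81 (L : ℕ) [NeZero L] (U : GaugeConfig 4 L SU3) {m : ℝ}
    (hm : m ∈ Set.Icc (-(1 / 2 : ℝ)) 1) (v : TorusSite 4 L × Fin 3 × Fin 4 → ℂ) :
    ∑ i, ‖(wilsonDirac ρ₃ U m 1).mulVec v i‖ ^ 2 ≤ 81 * ∑ i, ‖v i‖ ^ 2 := by
  refine (sum_norm_sq_mulVec_le _ v).trans ?_
  have hn := l2_opNorm_wilsonDirac_le ρ₃ fundamentalRep_mem_unitaryGroup U m
  have h9 : ‖wilsonDirac ρ₃ U m 1‖ ≤ 9 := by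
    refine hn.trans ?_
    rw [abs_of_pos (by linarith [hm.1])]
    linarith [hm.2]
  have h0 : 0 ≤ ∑ i, ‖v i‖ ^ 2 := Finset.sum_nonneg fun i _ => by positivity
  have : ‖wilsonDirac ρ₃ U m 1‖ ^ 2 ≤ 81 := by nlinarith [norm_nonneg (wilsonDirac ρ₃ U m 1)]
  exact mul_le_mul_of_nonneg_right this h0

/-- On the one-point torus at `m = 0` the hypothesis holds on the whole space with `λ = 0`
(`D_W = 0` there). -/
theorem hyp_top_zero_one (v : TorusSite 4 1 × Fin 3 × Fin 4 → ℂ) :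
    ∑ i, ‖(wilsonDirac ρ₃ (trivialConfig 1) 0 1).mulVec v i‖ ^ 2 ≤ 0 * ∑ i, ‖v i‖ ^ 2 := by
  simp [wilsonDirac_trivialConfig_one]

/-! ## (a) Load-bearing terms of the bound -/

/-- The crux with the additive `+ 1` dropped. -/
def WithoutOne : Prop :=
  ∃ C : ℝ, ∀ (L : ℕ) [NeZero L] (U : GaugeConfig 4 L SU3) (m : ℝ), m ∈ Set.Icc (-(1 / 2 : ℝ)) 1 →
    ∀ (lam : ℝ), 0 ≤ lam → ∀ (E : Submodule ℂ (TorusSite 4 L × Fin 3 × Fin 4 → ℂ)),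
      (∀ v ∈ E, ∑ i, ‖(wilsonDirac ρ₃ U m 1).mulVec v i‖ ^ 2 ≤ lam * ∑ i, ‖v i‖ ^ 2) →
        (Module.finrank ℂ E : ℝ) ≤ C * (lam ^ 2 * (L : ℝ) ^ 4 + wilsonAction ρ₃ U)

/-- ANY PROOF MUST USE THE `+ 1`: the 12 constant zero modes of the free massless operator
(here on the `1⁴` torus, where `D_W(U ≡ 1, m = 0) = 0`) have `λ = 0` and `S_W = 0`. -/
theorem not_withoutOne : ¬ WithoutOne := by
  rintro ⟨C, hC⟩
  have h := hC 1 (trivialConfig 1) 0 (by norm_num) 0 le_rfl ⊤ (fun v _ => hyp_top_zero_one v)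
  rw [finrank_top_quarkFields, wilsonAction_trivialConfig] at h
  norm_num at h

/-- The crux with the Weyl term `λ² L⁴` dropped. -/
def WithoutWeyl : Prop :=
  ∃ C : ℝ, ∀ (L : ℕ) [NeZero L] (U : GaugeConfig 4 L SU3) (m : ℝ), m ∈ Set.Icc (-(1 / 2 : ℝ)) 1 →
    ∀ (lam : ℝ), 0 ≤ lam → ∀ (E : Submodule ℂ (TorusSite 4 L × Fin 3 × Fin 4 → ℂ)),
      (∀ v ∈ E, ∑ i, ‖(wilsonDirac ρ₃ U m 1).mulVec v i‖ ^ 2 ≤ lam * ∑ i, ‖v i‖ ^ 2) →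
        (Module.finrank ℂ E : ℝ) ≤ C * (wilsonAction ρ₃ U + 1)

/-- ANY PROOF MUST USE THE WEYL TERM: with `λ = 81 ≥ ‖D_W‖²` the whole `12L⁴`-dimensional space
qualifies while `S_W(U ≡ 1) = 0`; take `L > C`. -/
theorem not_withoutWeyl : ¬ WithoutWeyl := by
  rintro ⟨C, hC⟩
  obtain ⟨L, hL⟩ := exists_nat_gt C
  have h := hC (L + 1) (trivialConfig (L + 1)) 0 (by norm_num) 81 (by norm_num) ⊤
    (fun v _ => hyp_top_81 (L + 1) (trivialConfig (L + 1)) (by norm_num) v)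
  rw [finrank_top_quarkFields, wilsonAction_trivialConfig] at h
  push_cast at h
  have h1 : (1 : ℝ) ≤ (L : ℝ) + 1 := by linarith [(Nat.cast_nonneg L : (0 : ℝ) ≤ L)]
  have h4 : (L : ℝ) + 1 ≤ ((L : ℝ) + 1) ^ 4 := le_self_pow₀ h1 (by norm_num)
  nlinarith

/-! ## (b) Tightness of the constant -/

/-- Any admissible constant is at least `12` (free constant zero modes on the `1⁴` torus:
`dim = 12`, `λ = 0`, `S_W = 0`). -/
theorem twelve_le_of_holds {C : ℝ} (h : Holds C) : 12 ≤ C := by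
  have h1 := h 1 (trivialConfig 1) 0 (by norm_num) 0 le_rfl ⊤ (fun v _ => hyp_top_zero_one v)
  rw [finrank_top_quarkFields, wilsonAction_trivialConfig] at h1
  norm_num at h1
  exact h1

/-- Hence the crux fails for every constant below `12` (a refuted strengthening, not a refutation). -/
theorem not_holds_of_lt_twelve {C : ℝ} (hC : C < 12) : ¬ Holds C :=
  fun h => (lt_irrefl C) (lt_of_lt_of_le hC (twelve_le_of_holds h))

/-! ## (d) Targets — none yet (no skeleton / stuck stubs at cycle 1) -/

/-! ## (e) Near-misses — none sorried; see the module docstring, item 4 (dilute-gas reduction) -/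

end Summit.QuantumFields.QCD.Cruxes.ActionBoundsLowModes.Disproof
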